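/-
Copyright (c) 2026 the pub-hodgecm-mathlib formalisation cell (harness21).  Prover seat hodgecm-mathlib-F0P2-p01 (g15): road «S3-ram» (architect A-p16 (g31) deal (a1)
«SHELL RECURSION over the fixed-child criterion», LABEL half; owner F0P3a-p06 (g15)), organ A′ (ii) «the child-LABEL transition law: depth»; 2026-09-01.
-/
import Literature.NumberTheory.Automorphic.UnitaryLatticeTreeFixedChildCountRamified   -- ★ p847085 (this seat): the COUNT half; brings ★ p847060 criterion, ★ R3, costar coordinates
import Literature.NumberTheory.Automorphic.UnitaryLatticeTreeLevelShift               -- ★ `map_sub_one_latt_le_scaleLattice_iff` (the level of `γ` at `latt g` in the frame `g`)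
import HarnessLib

/-!
# The lattice graph of a hermitian space — THE DEPTH OF A DEEP ELEMENT AT A CHILD VERTEX (tame-ramified place): the level drops by `2` when the residual corner
# `B₀(x, (γ−1)x)∕ϖ^d` is a unit and by `1` otherwise (Bruhat–Tits 1972 §10; Tits 1979 §3.5; Kottwitz 1986 §3)

Topic `NumberTheory/Automorphic`; namespace `Literature.NumberTheory.Automorphic.UnitaryLatticeTree`.  THEOREMS ONLY (no definition, no instance, no notation, no named fact,
no `sorry`); kernel lane `--supports stmt-HodgeConjecture-24833`.  Cell `pub/hodgecm-mathlib` (D-0151), crux H413; road «S3-ram», organ A′ (ii) of the P-1-ram skeleton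
(architect A-p16 (g31), ROAD-P1ram): the LABEL half of (a1) «shell recursion» — the COUNT half is ★ p847085.  DATUM-FREE (`K` with `Valued K ℤᵐ⁰`; the frame algebra of
§1–§2 needs NO hypothesis on `σ`; §3 uses `σ` valuation-preserving only).  Tokens of ★ `UnitaryLatticeTree*`: `L₀ = 𝒪³`, `N₁ = latt diag(1,1,ϖ)`, `w(a,b) = (a∕ϖ, 0, b)`,
`K₀ = unitaryInt`, the level of `γ` at `latt g` = «`(γ − 1)·latt g ⊆ c·latt g`» (★ `map_sub_one_latt_le_scaleLattice_iff`).

THE MATHEMATICS.  The CHILD of `L₀` through the modular neighbour `κ·N₁` (`κ ∈ K₀`, isotropic vector `x = κe₀`) with lift `b` is `κ·(N₁ + 𝒪w(a,b))`, `|a| = 1`; it has the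
FRAME `κ·g(a,b)`, `g(a,b) = [w(a,b) | e₁ | ϖe₂] = !![a∕ϖ, 0, 0; 0, 1, 0; b, 0, ϖ]` (`det = a`, §1).  For `γ ∈ K₀` with `γ ≡ 1 (mod ϖ^d)`, `d ≥ 2` (so the child IS fixed,
★ p847060 ∕ ★ p847085) put `M := κ⁻¹(γ − 1)κ` (entries `≤ |ϖ|^d`, `M₂₀ = B₀(x, (γ−1)x)` ★ `inv_mul_mul_apply_two_zero_eq_B₀`); the local element of `γ` at the child is
`g⁻¹ M g + 1` with (§2) `(g⁻¹Mg)₂₀ = (a∕ϖ²)·M₂₀ + (b∕ϖ)(M₂₂ − M₀₀) − (b²∕a)M₀₂`, `(g⁻¹Mg)₁₀ = (a∕ϖ)M₁₀ + bM₁₂`, `(g⁻¹Mg)₂₁ = M₂₁∕ϖ − (b∕a)M₀₁`, the other entries integral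
multiples of the `M_{ij}`.  Hence (§2) **the level of `γ` at the child is `≥ d − 2` ALWAYS, and `≥ d − 1` IFF `|B₀(x, (γ−1)x)| ≤ |ϖ|^{d+1}`** (the residual corner
`B̄₀(x̄, Ȳx̄)`, `Ȳ = (γ−1)∕ϖ^d`, vanishes) — the DEPTH column of the certificate's child-label law (CERT smoke v1.3 §6, A-p16 (g31): «drop 2 iff the corner is a unit, else drop 1»;
at even `d` the residual `Ȳ` is `J₀`-skew, its corner vanishes and the drop is always `1`); the LATTICE reading «`(γ − 1)·Λ′ ⊆ ϖ^k·Λ′`» for `Λ′ = κ·(N₁ + 𝒪w(a,b)) =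
latt (κ·g(a,b))` (§1 `latt_childFrame_eq`) is ★ `map_sub_one_latt_le_scaleLattice_iff` applied to the frame `κ·g(a,b)` (the consumer's one-liner).  §3: the leading FORM VALUE at the child's generator `v = κ·w(a,b)`:
`B₀(v, (γ−1)v) = σ(a∕ϖ)(a∕ϖ)·B₀(x,(γ−1)x) + (terms of size ≤ |ϖ|^{d−1})` — the frame-intrinsic square-class token of the two-layer strata (★ p847010 (R4)) one level down.

* §1 `det_childFrame`, `childFrame_mulVec_single_{zero,one,two}`, **`latt_childFrame_eq`** (`latt g(a,b) = N₁ + 𝒪w(a,b)` for `|a| = 1`), `inv_childFrame_mul_childFrame`.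
* §2 **`childFrame_conj_apply`** (the nine entries of `g⁻¹Mg`), **`v_childFrame_conj_le_of_le`** (`≤ |ϖ|^(d−2)`), **`v_childFrame_conj_le_iff_of_le`** (`≤ |ϖ|^(d−1) ↔ |M₂₀| ≤ |ϖ|^(d+1)`); the lattice reading via ★ `map_sub_one_latt_le_scaleLattice_iff`.
* §3 **`B₀_childVec_eq`** — `B₀(w, Mw) = σ(a∕ϖ)(a∕ϖ)M₂₀ + σ(a∕ϖ)b M₂₂ + σ(b)(a∕ϖ)M₀₀ + σ(b)b M₀₂`, and `v_B₀_childVec_sub_le` (the three tail terms are `≤ |ϖ|^(d−1)`).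

HONEST LABEL: HC_CM is proved only modulo the 2 remaining named inputs (hLiu418 24832, h413 24833) until rung 0 closes; nothing printed is asserted here (elementary lattice
algebra over a valuation ring); «S3-ram» has no books consequence.

## References
* [BruhatTits1972] F. Bruhat, J. Tits, *Groupes réductifs sur un corps local I*, Publ. Math. IHÉS 41 (1972), §10 (lattice models; vertex stabilisers and their filtrations).
* [Tits1979] J. Tits, *Reductive groups over local fields*, PSPM 33.1 (1979), §3.5 (congruence filtration; reduction mod `𝔭`).
* [Kottwitz1986] R. E. Kottwitz, *Base change for unit elements of Hecke algebras*, Compositio Math. 60 (1986), §3 (the level of a fixed lattice; shell recursion).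
* [Serre1980Trees] J.-P. Serre, *Trees* (1980), Ch. II §1.1–1.2 (lattices, frames, congruence level of a stabiliser).
-/

set_option autoImplicit false

noncomputable section

open scoped Valued WithZero Matrix MatrixGroups

namespace Literature.NumberTheory.Automorphic.UnitaryLatticeTree

open Literature.NumberTheory.Automorphic Literature.NumberTheory.Automorphic.HermitianLattice

variable {K : Type*} [Field K] [Valued K ℤᵐ⁰] {σ : K →+* K} {ϖ : K}

/-! ## §1 The child frame `g(a,b) = [w(a,b) | e₁ | ϖe₂]` -/

omit [Valued K ℤᵐ⁰] in
/-- `det g(a,b) = a`. [cite: Serre1980Trees, II.1.1] -/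
theorem det_childFrame (hϖ0 : ϖ ≠ 0) (a b : K) : (!![a / ϖ, 0, 0; 0, 1, 0; b, 0, ϖ] : Matrix (Fin 3) (Fin 3) K).det = a := by
  rw [Matrix.det_fin_three]; simp; field_simp

omit [Valued K ℤᵐ⁰] in
/-- The columns of `g(a,b)`: `w(a,b)`, `e₁`, `ϖe₂`. [cite: Serre1980Trees, II.1.1] -/
theorem childFrame_mulVec_single_zero (a b : K) :
    (!![a / ϖ, 0, 0; 0, 1, 0; b, 0, ϖ] : Matrix (Fin 3) (Fin 3) K).mulVec (Pi.single 0 1) = ![a / ϖ, 0, b] := by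
  rw [Matrix.mulVec_single_one]; funext i; fin_cases i <;> simp

omit [Valued K ℤᵐ⁰] in
/-- The columns of `g(a,b)`: `w(a,b)`, `e₁`, `ϖe₂`. [cite: Serre1980Trees, II.1.1] -/
theorem childFrame_mulVec_single_one (a b : K) :
    (!![a / ϖ, 0, 0; 0, 1, 0; b, 0, ϖ] : Matrix (Fin 3) (Fin 3) K).mulVec (Pi.single 1 1) = Pi.single 1 1 := by
  rw [Matrix.mulVec_single_one]; funext i; fin_cases i <;> simp

omit [Valued K ℤᵐ⁰] in
/-- The columns of `g(a,b)`: `w(a,b)`, `e₁`, `ϖe₂`. [cite: Serre1980Trees, II.1.1] -/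
theorem childFrame_mulVec_single_two (a b : K) :
    (!![a / ϖ, 0, 0; 0, 1, 0; b, 0, ϖ] : Matrix (Fin 3) (Fin 3) K).mulVec (Pi.single 2 1) = ϖ • Pi.single 2 1 := by
  rw [Matrix.mulVec_single_one]; funext i; fin_cases i <;> simp

/-- **`latt g(a,b) = N₁ + 𝒪w(a,b)` for `|a| = 1`, `|b| ≤ 1`** (the frame of the child; the computation of ★ `isSelfDualLattice_N₁_sup_span_vec_of_neg`, exported).
[cite: Serre1980Trees, II.1.1] [cite: BruhatTits1972, §10] -/
theorem latt_childFrame_eq (hϖ : Valued.v ϖ = WithZero.exp (-1 : ℤ)) {a b : K} (ha : Valued.v a = 1) (hb : Valued.v b ≤ 1) :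
    latt (!![a / ϖ, 0, 0; 0, 1, 0; b, 0, ϖ] : Matrix (Fin 3) (Fin 3) K) =
      latt (Matrix.diagonal ![(1 : K), 1, ϖ]) ⊔ Submodule.span 𝒪[K] {(![a / ϖ, 0, b] : Fin 3 → K)} := by
  have hϖ0 : ϖ ≠ 0 := fun h0 => by rw [h0, map_zero] at hϖ; exact WithZero.coe_ne_zero hϖ.symm
  have hϖ1 : Valued.v ϖ ≤ 1 := by rw [hϖ, ← WithZero.exp_zero]; exact WithZero.exp_le_exp.2 (by norm_num)
  have hd' : ∀ i, (![(1 : K), 1, ϖ] : Fin 3 → K) i ≠ 0 := by intro i; fin_cases i <;> simp [hϖ0]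
  have ha0 : a ≠ 0 := fun h0 => by rw [h0, map_zero] at ha; exact zero_ne_one ha
  set g : Matrix (Fin 3) (Fin 3) K := !![a / ϖ, 0, 0; 0, 1, 0; b, 0, ϖ] with hg
  have hcol0 : g.mulVec (Pi.single 0 1) = ![a / ϖ, 0, b] := childFrame_mulVec_single_zero a b
  have hcol1 : g.mulVec (Pi.single 1 1) = Pi.single 1 1 := childFrame_mulVec_single_one a b
  have hcol2 : g.mulVec (Pi.single 2 1) = ϖ • Pi.single 2 1 := childFrame_mulVec_single_two a b
  apply le_antisymm
  · refine (latt_le_iff_forall_mulVec_single_mem _ _).2 fun j => ?_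
    fin_cases j
    · rw [Fin.zero_eta, hcol0]; exact Submodule.mem_sup_right (Submodule.mem_span_singleton_self _)
    · rw [Fin.mk_one, hcol1]
      exact Submodule.mem_sup_left ((mem_latt_diagonal_iff hd' _).2 fun i => by fin_cases i <;> simp)
    · simp only [Fin.reduceFinMk]; rw [hcol2]
      refine Submodule.mem_sup_left ((mem_latt_diagonal_iff hd' _).2 fun i => ?_)
      fin_cases i <;> simp
  · refine sup_le ((latt_le_iff_forall_mulVec_single_mem _ _).2 fun j => ?_) ((Submodule.span_singleton_le_iff_mem _ _).2 ?_)
    · fin_cases j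
      · have hmem : ((⟨ϖ / a, (Valuation.mem_integer_iff _ _).2 (by rw [map_div₀, ha, div_one]; exact hϖ1)⟩ : 𝒪[K]) • g.mulVec (Pi.single 0 1) -
            (⟨b / a, (Valuation.mem_integer_iff _ _).2 (by rw [map_div₀, ha, div_one]; exact hb)⟩ : 𝒪[K]) • g.mulVec (Pi.single 2 1)) ∈ latt g :=
          Submodule.sub_mem _ (Submodule.smul_mem _ _ (mulVec_single_mem_latt g 0)) (Submodule.smul_mem _ _ (mulVec_single_mem_latt g 2))
        have heq : ((⟨ϖ / a, (Valuation.mem_integer_iff _ _).2 (by rw [map_div₀, ha, div_one]; exact hϖ1)⟩ : 𝒪[K]) • g.mulVec (Pi.single 0 1) -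
            (⟨b / a, (Valuation.mem_integer_iff _ _).2 (by rw [map_div₀, ha, div_one]; exact hb)⟩ : 𝒪[K]) • g.mulVec (Pi.single 2 1) : Fin 3 → K) =
            (Matrix.diagonal ![(1 : K), 1, ϖ]).mulVec (Pi.single 0 1) := by
          change (ϖ / a) • g.mulVec (Pi.single 0 1) - (b / a) • g.mulVec (Pi.single 2 1) = _
          rw [hcol0, hcol2, Matrix.mulVec_single_one]
          funext i; fin_cases i <;> simp <;> field_simp
          ring
        rw [Fin.zero_eta, ← heq]; exact hmem
      · have : (Matrix.diagonal ![(1 : K), 1, ϖ]).mulVec (Pi.single 1 1) = g.mulVec (Pi.single 1 1) := by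
          rw [hcol1, Matrix.mulVec_single_one]; funext i; fin_cases i <;> simp
        rw [Fin.mk_one, this]; exact mulVec_single_mem_latt g 1
      · have : (Matrix.diagonal ![(1 : K), 1, ϖ]).mulVec (Pi.single 2 1) = g.mulVec (Pi.single 2 1) := by
          rw [hcol2, Matrix.mulVec_single_one]; funext i; fin_cases i <;> simp
        simp only [Fin.reduceFinMk]; rw [this]; exact mulVec_single_mem_latt g 2
    · rw [← hcol0]; exact mulVec_single_mem_latt g 0

omit [Valued K ℤᵐ⁰] in
/-- The inverse of the child frame: `g(a,b)⁻¹ = !![ϖ∕a, 0, 0; 0, 1, 0; −b∕a, 0, ϖ⁻¹]`. [cite: Serre1980Trees, II.1.1] -/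
theorem inv_childFrame_mul_childFrame (hϖ0 : ϖ ≠ 0) {a : K} (ha0 : a ≠ 0) (b : K) :
    (!![ϖ / a, 0, 0; 0, 1, 0; -b / a, 0, ϖ⁻¹] : Matrix (Fin 3) (Fin 3) K) * !![a / ϖ, 0, 0; 0, 1, 0; b, 0, ϖ] = 1 := by
  ext i j
  fin_cases i <;> fin_cases j
  all_goals simp [Matrix.mul_apply, Fin.sum_univ_three]
  all_goals try field_simp
  all_goals try ring

/-! ## §2 Conjugation of an integral matrix by the child frame -/

omit [Valued K ℤᵐ⁰] in
/-- **THE NINE ENTRIES OF `g(a,b)⁻¹ · M · g(a,b)`** (pure algebra, `a, ϖ ≠ 0`). [cite: Kottwitz1986, §3] [cite: Serre1980Trees, II.1.2] -/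
theorem childFrame_conj_eq (hϖ0 : ϖ ≠ 0) {a : K} (ha0 : a ≠ 0) (b : K) (M : Matrix (Fin 3) (Fin 3) K) :
    (!![ϖ / a, 0, 0; 0, 1, 0; -b / a, 0, ϖ⁻¹] : Matrix (Fin 3) (Fin 3) K) * M * !![a / ϖ, 0, 0; 0, 1, 0; b, 0, ϖ] =
      !![M 0 0 + (ϖ * b / a) * M 0 2, (ϖ / a) * M 0 1, (ϖ ^ 2 / a) * M 0 2;
         (a / ϖ) * M 1 0 + b * M 1 2, M 1 1, ϖ * M 1 2;
         (a / ϖ ^ 2) * M 2 0 + (b / ϖ) * (M 2 2 - M 0 0) - (b ^ 2 / a) * M 0 2, ϖ⁻¹ * M 2 1 - (b / a) * M 0 1, M 2 2 - (ϖ * b / a) * M 0 2] := by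
  ext i j
  fin_cases i <;> fin_cases j
  all_goals simp [Matrix.mul_apply, Matrix.vecMul, dotProduct, Fin.sum_univ_three]
  all_goals try field_simp
  all_goals try ring

/-- **The conjugate of a level-`ϖ^d` matrix by the child frame has level `≥ ϖ^{d−2}`** (`|a| = 1`, `|b| ≤ 1`, `d ≥ 2`). [cite: Kottwitz1986, §3] [cite: Tits1979, §3.5] -/
theorem v_childFrame_conj_le_of_le (hϖ : Valued.v ϖ = WithZero.exp (-1 : ℤ)) {a b : K} (ha : Valued.v a = 1) (hb : Valued.v b ≤ 1)
    {d : ℕ} (hd : 2 ≤ d) {M : Matrix (Fin 3) (Fin 3) K} (hM : ∀ i j, Valued.v (M i j) ≤ Valued.v ϖ ^ d) (i j : Fin 3) :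
    Valued.v (((!![ϖ / a, 0, 0; 0, 1, 0; -b / a, 0, ϖ⁻¹] : Matrix (Fin 3) (Fin 3) K) * M * !![a / ϖ, 0, 0; 0, 1, 0; b, 0, ϖ]) i j) ≤ Valued.v ϖ ^ (d - 2) := by
  have hϖ0 : ϖ ≠ 0 := fun h0 => by rw [h0, map_zero] at hϖ; exact WithZero.coe_ne_zero hϖ.symm
  have hvϖ0 : Valued.v ϖ ≠ 0 := (Valuation.ne_zero_iff _).2 hϖ0
  have ha0 : a ≠ 0 := fun h0 => by rw [h0, map_zero] at ha; exact zero_ne_one ha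
  have hϖ1 : Valued.v ϖ ≤ 1 := by rw [hϖ, ← WithZero.exp_zero]; exact WithZero.exp_le_exp.2 (by norm_num)
  -- `|ϖ|^d ≤ |ϖ|^(d-1) ≤ |ϖ|^(d-2)`, and the scaled bounds
  have hpow : ∀ {m n : ℕ}, n ≤ m → Valued.v ϖ ^ m ≤ Valued.v ϖ ^ n := fun {m n} h => pow_le_pow_right_of_le_one' hϖ1 h
  have hd2 : Valued.v ϖ ^ d = Valued.v ϖ ^ 2 * Valued.v ϖ ^ (d - 2) := by rw [← pow_add]; congr 1; omega
  have hd1 : Valued.v ϖ ^ d = Valued.v ϖ * Valued.v ϖ ^ (d - 1) := by rw [← pow_succ']; congr 1; omega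
  have hM' : ∀ i j, Valued.v (M i j) ≤ Valued.v ϖ ^ (d - 2) := fun i j => (hM i j).trans (hpow (by omega))
  have hM'' : ∀ i j, Valued.v (M i j) ≤ Valued.v ϖ ^ (d - 1) := fun i j => (hM i j).trans (hpow (by omega))
  have h1 : Valued.v ϖ ^ (d - 1) ≤ Valued.v ϖ ^ (d - 2) := hpow (by omega)
  -- generic bounds for the coefficient shapes
  have hba : Valued.v (b / a) ≤ 1 := by rw [map_div₀, ha, div_one]; exact hb
  have hϖa : Valued.v (ϖ / a) ≤ 1 := by rw [map_div₀, ha, div_one]; exact hϖ1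
  have hϖba : Valued.v (ϖ * b / a) ≤ 1 := by rw [map_div₀, map_mul, ha, div_one]; exact mul_le_one' hϖ1 hb
  have hϖ2a : Valued.v (ϖ ^ 2 / a) ≤ 1 := by rw [map_div₀, map_pow, ha, div_one]; exact pow_le_one₀ zero_le hϖ1
  have hb2a : Valued.v (b ^ 2 / a) ≤ 1 := by rw [map_div₀, map_pow, ha, div_one]; exact pow_le_one₀ zero_le hb
  have hmul1 : ∀ {c x : K} {t : ℤᵐ⁰}, Valued.v c ≤ 1 → Valued.v x ≤ t → Valued.v (c * x) ≤ t := fun {c x t} hc hx => by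
    rw [map_mul]; exact (mul_le_of_le_one_left zero_le hc).trans hx
  -- the two scaled corner terms
  have h20 : Valued.v (a / ϖ ^ 2 * M 2 0) ≤ Valued.v ϖ ^ (d - 2) := by
    rw [map_mul, map_div₀, map_pow, ha, one_div]
    calc (Valued.v ϖ ^ 2)⁻¹ * Valued.v (M 2 0) ≤ (Valued.v ϖ ^ 2)⁻¹ * Valued.v ϖ ^ d := mul_le_mul' le_rfl (hM 2 0)
      _ = Valued.v ϖ ^ (d - 2) := by rw [hd2, ← mul_assoc, inv_mul_cancel₀ (pow_ne_zero _ hvϖ0), one_mul]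
  have hsc1 : ∀ {x : K}, Valued.v x ≤ Valued.v ϖ ^ d → Valued.v (ϖ⁻¹ * x) ≤ Valued.v ϖ ^ (d - 1) := fun {x} hx => by
    rw [map_mul, map_inv₀]
    calc (Valued.v ϖ)⁻¹ * Valued.v x ≤ (Valued.v ϖ)⁻¹ * Valued.v ϖ ^ d := mul_le_mul' le_rfl hx
      _ = Valued.v ϖ ^ (d - 1) := by rw [hd1, ← mul_assoc, inv_mul_cancel₀ hvϖ0, one_mul]
  have h10 : Valued.v (a / ϖ * M 1 0) ≤ Valued.v ϖ ^ (d - 1) := by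
    have : a / ϖ * M 1 0 = a * (ϖ⁻¹ * M 1 0) := by field_simp
    rw [this, map_mul, ha, one_mul]; exact hsc1 (hM 1 0)
  have hbϖ : Valued.v (b / ϖ * (M 2 2 - M 0 0)) ≤ Valued.v ϖ ^ (d - 1) := by
    have : b / ϖ * (M 2 2 - M 0 0) = b * (ϖ⁻¹ * (M 2 2 - M 0 0)) := by field_simp
    rw [this]
    exact hmul1 hb (hsc1 ((Valuation.map_sub _ _ _).trans (max_le (hM 2 2) (hM 0 0))))
  have h21 : Valued.v (ϖ⁻¹ * M 2 1) ≤ Valued.v ϖ ^ (d - 1) := hsc1 (hM 2 1)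
  rw [childFrame_conj_eq hϖ0 ha0]
  fin_cases i <;> fin_cases j
  · simpa using (Valuation.map_add _ _ _).trans (max_le (hM' 0 0) (hmul1 hϖba (hM' 0 2)))
  · simpa using hmul1 hϖa (hM' 0 1)
  · simpa using hmul1 hϖ2a (hM' 0 2)
  · simpa using (Valuation.map_add _ _ _).trans (max_le (h10.trans h1) (hmul1 hb (hM' 1 2)))
  · simpa using hM' 1 1
  · simpa using hmul1 hϖ1 (hM' 1 2)
  · simpa using (Valuation.map_sub _ _ _).trans (max_le ((Valuation.map_add _ _ _).trans (max_le h20 (hbϖ.trans h1))) (hmul1 hb2a (hM' 0 2)))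
  · simpa using (Valuation.map_sub _ _ _).trans (max_le (h21.trans h1) (hmul1 hba (hM' 0 1)))
  · simpa using (Valuation.map_sub _ _ _).trans (max_le (hM' 2 2) (hmul1 hϖba (hM' 0 2)))

/-- **… and level `≥ ϖ^{d−1}` IFF the corner `M₂₀` is one order deeper: `|M₂₀| ≤ |ϖ|^{d+1}`** (all other entries of `g⁻¹Mg` are `≤ |ϖ|^{d−1}` for free; the corner entry is
`(a∕ϖ²)M₂₀ +` terms of that size). [cite: Kottwitz1986, §3] [cite: Tits1979, §3.5] -/
theorem v_childFrame_conj_le_iff_of_le (hϖ : Valued.v ϖ = WithZero.exp (-1 : ℤ)) {a b : K} (ha : Valued.v a = 1) (hb : Valued.v b ≤ 1)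
    {d : ℕ} (hd : 2 ≤ d) {M : Matrix (Fin 3) (Fin 3) K} (hM : ∀ i j, Valued.v (M i j) ≤ Valued.v ϖ ^ d) :
    (∀ i j : Fin 3, Valued.v (((!![ϖ / a, 0, 0; 0, 1, 0; -b / a, 0, ϖ⁻¹] : Matrix (Fin 3) (Fin 3) K) * M * !![a / ϖ, 0, 0; 0, 1, 0; b, 0, ϖ]) i j) ≤ Valued.v ϖ ^ (d - 1)) ↔
      Valued.v (M 2 0) ≤ Valued.v ϖ ^ (d + 1) := by
  have hϖ0 : ϖ ≠ 0 := fun h0 => by rw [h0, map_zero] at hϖ; exact WithZero.coe_ne_zero hϖ.symm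
  have hvϖ0 : Valued.v ϖ ≠ 0 := (Valuation.ne_zero_iff _).2 hϖ0
  have ha0 : a ≠ 0 := fun h0 => by rw [h0, map_zero] at ha; exact zero_ne_one ha
  have hϖ1 : Valued.v ϖ ≤ 1 := by rw [hϖ, ← WithZero.exp_zero]; exact WithZero.exp_le_exp.2 (by norm_num)
  have hpow : ∀ {m n : ℕ}, n ≤ m → Valued.v ϖ ^ m ≤ Valued.v ϖ ^ n := fun {m n} h => pow_le_pow_right_of_le_one' hϖ1 h
  have hd1 : Valued.v ϖ ^ d = Valued.v ϖ * Valued.v ϖ ^ (d - 1) := by rw [← pow_succ']; congr 1; omega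
  have hd3 : Valued.v ϖ ^ (d + 1) = Valued.v ϖ ^ 2 * Valued.v ϖ ^ (d - 1) := by rw [← pow_add]; congr 1; omega
  have hM'' : ∀ i j, Valued.v (M i j) ≤ Valued.v ϖ ^ (d - 1) := fun i j => (hM i j).trans (hpow (by omega))
  have hba : Valued.v (b / a) ≤ 1 := by rw [map_div₀, ha, div_one]; exact hb
  have hϖa : Valued.v (ϖ / a) ≤ 1 := by rw [map_div₀, ha, div_one]; exact hϖ1
  have hϖba : Valued.v (ϖ * b / a) ≤ 1 := by rw [map_div₀, map_mul, ha, div_one]; exact mul_le_one' hϖ1 hb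
  have hϖ2a : Valued.v (ϖ ^ 2 / a) ≤ 1 := by rw [map_div₀, map_pow, ha, div_one]; exact pow_le_one₀ zero_le hϖ1
  have hb2a : Valued.v (b ^ 2 / a) ≤ 1 := by rw [map_div₀, map_pow, ha, div_one]; exact pow_le_one₀ zero_le hb
  have hmul1 : ∀ {c x : K} {t : ℤᵐ⁰}, Valued.v c ≤ 1 → Valued.v x ≤ t → Valued.v (c * x) ≤ t := fun {c x t} hc hx => by
    rw [map_mul]; exact (mul_le_of_le_one_left zero_le hc).trans hx
  have hsc1 : ∀ {x : K}, Valued.v x ≤ Valued.v ϖ ^ d → Valued.v (ϖ⁻¹ * x) ≤ Valued.v ϖ ^ (d - 1) := fun {x} hx => by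
    rw [map_mul, map_inv₀]
    calc (Valued.v ϖ)⁻¹ * Valued.v x ≤ (Valued.v ϖ)⁻¹ * Valued.v ϖ ^ d := mul_le_mul' le_rfl hx
      _ = Valued.v ϖ ^ (d - 1) := by rw [hd1, ← mul_assoc, inv_mul_cancel₀ hvϖ0, one_mul]
  have h10 : Valued.v (a / ϖ * M 1 0) ≤ Valued.v ϖ ^ (d - 1) := by
    have : a / ϖ * M 1 0 = a * (ϖ⁻¹ * M 1 0) := by field_simp
    rw [this, map_mul, ha, one_mul]; exact hsc1 (hM 1 0)
  have hbϖ : Valued.v (b / ϖ * (M 2 2 - M 0 0)) ≤ Valued.v ϖ ^ (d - 1) := by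
    have : b / ϖ * (M 2 2 - M 0 0) = b * (ϖ⁻¹ * (M 2 2 - M 0 0)) := by field_simp
    rw [this]
    exact hmul1 hb (hsc1 ((Valuation.map_sub _ _ _).trans (max_le (hM 2 2) (hM 0 0))))
  have h21 : Valued.v (ϖ⁻¹ * M 2 1) ≤ Valued.v ϖ ^ (d - 1) := hsc1 (hM 2 1)
  -- the tail of the corner entry
  have htail : Valued.v (b / ϖ * (M 2 2 - M 0 0) - b ^ 2 / a * M 0 2) ≤ Valued.v ϖ ^ (d - 1) :=
    (Valuation.map_sub _ _ _).trans (max_le hbϖ (hmul1 hb2a (hM'' 0 2)))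
  -- `|a∕ϖ² · M₂₀| ≤ |ϖ|^(d-1) ↔ |M₂₀| ≤ |ϖ|^(d+1)`
  have hcorner : Valued.v (a / ϖ ^ 2 * M 2 0) ≤ Valued.v ϖ ^ (d - 1) ↔ Valued.v (M 2 0) ≤ Valued.v ϖ ^ (d + 1) := by
    rw [map_mul, map_div₀, map_pow, ha, one_div, hd3]
    have hp : 0 < Valued.v ϖ ^ 2 := pow_pos (zero_lt_iff.2 hvϖ0) 2
    constructor
    · intro h
      have h' := mul_le_mul' (le_refl (Valued.v ϖ ^ 2)) h
      rwa [← mul_assoc, mul_inv_cancel₀ (pow_ne_zero _ hvϖ0), one_mul] at h'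
    · intro h
      have h' := mul_le_mul' (le_refl ((Valued.v ϖ ^ 2)⁻¹)) h
      rwa [← mul_assoc, inv_mul_cancel₀ (pow_ne_zero _ hvϖ0), one_mul] at h'
  rw [childFrame_conj_eq hϖ0 ha0]
  constructor
  · intro h
    have h20 : Valued.v (a / ϖ ^ 2 * M 2 0 + b / ϖ * (M 2 2 - M 0 0) - b ^ 2 / a * M 0 2) ≤ Valued.v ϖ ^ (d - 1) := h 2 0
    -- isolate the corner term: `x = (x + t) - t`
    have hx : Valued.v (a / ϖ ^ 2 * M 2 0) ≤ Valued.v ϖ ^ (d - 1) := by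
      have e : a / ϖ ^ 2 * M 2 0 = (a / ϖ ^ 2 * M 2 0 + b / ϖ * (M 2 2 - M 0 0) - b ^ 2 / a * M 0 2) - (b / ϖ * (M 2 2 - M 0 0) - b ^ 2 / a * M 0 2) := by ring
      rw [e]
      exact (Valuation.map_sub _ _ _).trans (max_le h20 htail)
    exact hcorner.1 hx
  · intro h i j
    have h20 : Valued.v (a / ϖ ^ 2 * M 2 0) ≤ Valued.v ϖ ^ (d - 1) := hcorner.2 h
    fin_cases i <;> fin_cases j
    · simpa using (Valuation.map_add _ _ _).trans (max_le (hM'' 0 0) (hmul1 hϖba (hM'' 0 2)))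
    · simpa using hmul1 hϖa (hM'' 0 1)
    · simpa using hmul1 hϖ2a (hM'' 0 2)
    · simpa using (Valuation.map_add _ _ _).trans (max_le h10 (hmul1 hb (hM'' 1 2)))
    · simpa using hM'' 1 1
    · simpa using hmul1 hϖ1 (hM'' 1 2)
    · have e : a / ϖ ^ 2 * M 2 0 + b / ϖ * (M 2 2 - M 0 0) - b ^ 2 / a * M 0 2 = a / ϖ ^ 2 * M 2 0 + (b / ϖ * (M 2 2 - M 0 0) - b ^ 2 / a * M 0 2) := by ring
      simpa [e] using (Valuation.map_add _ _ _).trans (max_le h20 htail)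
    · simpa using (Valuation.map_sub _ _ _).trans (max_le h21 (hmul1 hba (hM'' 0 1)))
    · simpa using (Valuation.map_sub _ _ _).trans (max_le (hM'' 2 2) (hmul1 hϖba (hM'' 0 2)))

/-! ## §3 The leading form value at the child's generator -/

omit [Valued K ℤᵐ⁰] in
/-- **`B₀(w, Mw)` in coordinates** (`w = w(a,b) = (a∕ϖ, 0, b)`; any `σ`): `= σ(a∕ϖ)·((a∕ϖ)M₂₀ + b·M₂₂) + σ(b)·((a∕ϖ)M₀₀ + b·M₀₂)`.
[cite: Kottwitz1986, §3] [cite: BruhatTits1972, §10] -/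
theorem B₀_childVec_eq (a b : K) (M : Matrix (Fin 3) (Fin 3) K) :
    B₀ σ 3 (![a / ϖ, 0, b] : Fin 3 → K) (M.mulVec (![a / ϖ, 0, b] : Fin 3 → K)) =
      σ (a / ϖ) * ((a / ϖ) * M 2 0 + b * M 2 2) + σ b * ((a / ϖ) * M 0 0 + b * M 0 2) := by
  rw [B₀_apply]
  simp [Matrix.mulVec, dotProduct, Fin.sum_univ_three, Fin.rev]
  ring

/-- **THE LEADING FORM VALUE AT THE CHILD'S GENERATOR**: for `|a| = 1`, `|b| ≤ 1`, `σ` valuation-preserving and `M` of level `ϖ^d`,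
`|B₀(w, Mw) − σ(a∕ϖ)(a∕ϖ)·M₂₀| ≤ |ϖ|^{d−1}` — the corner `M₂₀ = B₀(x,(γ−1)x)` of the parent, rescaled by the norm `σ(a∕ϖ)(a∕ϖ) = −σ(a)a∕ϖ²` at a ramified place, is the
leading term (size `|ϖ|^{d−2}` when the corner is a unit multiple of `ϖ^d`): the frame-intrinsic square-class token of the child one level down. [cite: Kottwitz1986, §3] [cite: Tits1979, §3.5] -/
theorem v_B₀_childVec_sub_le (hvσ : ∀ z, Valued.v (σ z) = Valued.v z) (hϖ : Valued.v ϖ = WithZero.exp (-1 : ℤ)) {a b : K} (ha : Valued.v a = 1) (hb : Valued.v b ≤ 1)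
    {d : ℕ} (hd : 2 ≤ d) {M : Matrix (Fin 3) (Fin 3) K} (hM : ∀ i j, Valued.v (M i j) ≤ Valued.v ϖ ^ d) :
    Valued.v (B₀ σ 3 (![a / ϖ, 0, b] : Fin 3 → K) (M.mulVec (![a / ϖ, 0, b] : Fin 3 → K)) - σ (a / ϖ) * (a / ϖ) * M 2 0) ≤ Valued.v ϖ ^ (d - 1) := by
  have hϖ0 : ϖ ≠ 0 := fun h0 => by rw [h0, map_zero] at hϖ; exact WithZero.coe_ne_zero hϖ.symm
  have hvϖ0 : Valued.v ϖ ≠ 0 := (Valuation.ne_zero_iff _).2 hϖ0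
  have hϖ1 : Valued.v ϖ ≤ 1 := by rw [hϖ, ← WithZero.exp_zero]; exact WithZero.exp_le_exp.2 (by norm_num)
  have hpow : ∀ {m n : ℕ}, n ≤ m → Valued.v ϖ ^ m ≤ Valued.v ϖ ^ n := fun {m n} h => pow_le_pow_right_of_le_one' hϖ1 h
  have hd1 : Valued.v ϖ ^ d = Valued.v ϖ * Valued.v ϖ ^ (d - 1) := by rw [← pow_succ']; congr 1; omega
  have hM'' : ∀ i j, Valued.v (M i j) ≤ Valued.v ϖ ^ (d - 1) := fun i j => (hM i j).trans (hpow (by omega))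
  have haϖ : Valued.v (a / ϖ) = (Valued.v ϖ)⁻¹ := by rw [map_div₀, ha, one_div]
  have hsc1 : ∀ {x : K}, Valued.v x ≤ Valued.v ϖ ^ d → Valued.v (a / ϖ * x) ≤ Valued.v ϖ ^ (d - 1) := fun {x} hx => by
    rw [map_mul, haϖ]
    calc (Valued.v ϖ)⁻¹ * Valued.v x ≤ (Valued.v ϖ)⁻¹ * Valued.v ϖ ^ d := mul_le_mul' le_rfl hx
      _ = Valued.v ϖ ^ (d - 1) := by rw [hd1, ← mul_assoc, inv_mul_cancel₀ hvϖ0, one_mul]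
  have e : B₀ σ 3 (![a / ϖ, 0, b] : Fin 3 → K) (M.mulVec (![a / ϖ, 0, b] : Fin 3 → K)) - σ (a / ϖ) * (a / ϖ) * M 2 0 =
      σ (a / ϖ) * b * M 2 2 + σ b * ((a / ϖ) * M 0 0 + b * M 0 2) := by
    rw [B₀_childVec_eq]; ring
  rw [e]
  refine (Valuation.map_add _ _ _).trans (max_le ?_ ?_)
  · -- `|σ(a/ϖ)·b·M₂₂| = |ϖ|⁻¹|b||M₂₂| ≤ |ϖ|^(d-1)`
    have : σ (a / ϖ) * b * M 2 2 = b * (σ (a / ϖ) * M 2 2) := by ring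
    rw [this, map_mul]
    refine (mul_le_of_le_one_left zero_le hb).trans ?_
    rw [map_mul, hvσ, haϖ]
    calc (Valued.v ϖ)⁻¹ * Valued.v (M 2 2) ≤ (Valued.v ϖ)⁻¹ * Valued.v ϖ ^ d := mul_le_mul' le_rfl (hM 2 2)
      _ = Valued.v ϖ ^ (d - 1) := by rw [hd1, ← mul_assoc, inv_mul_cancel₀ hvϖ0, one_mul]
  · rw [map_mul, hvσ]
    refine (mul_le_of_le_one_left zero_le hb).trans ((Valuation.map_add _ _ _).trans (max_le (hsc1 (hM 0 0)) ?_))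
    rw [map_mul]; exact (mul_le_of_le_one_left zero_le hb).trans (hM'' 0 2)

end Literature.NumberTheory.Automorphic.UnitaryLatticeTree

end
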